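import Literature.NumberTheory.GaloisRepresentations.LubinTateNormGroup
import Literature.NumberTheory.GaloisRepresentations.LubinTateTowerGenerator
import HarnessLib

/-!
# Coleman's norm operator does not depend on the level; values of `𝒩`-iterates and congruences

De Shalit, *Iwasawa theory of elliptic curves with complex multiplication* (1987), Ch. I §2.1–2.2.
The tree's Coleman norm operator `colemanNorm hπ n : 𝒪_F⟦X⟧ → 𝒪_F⟦X⟧` (`LubinTateColemanNorm.lean`)
is COMPUTED inside the Lubin–Tate field `K_π^{n+1}` (through the `π`-division points `W_f^1 ⊆ 𝔪_{K_π^{n+1}}`)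
and nominally depends on `n`; de Shalit's `𝒩` of course does not ("(1) characterizes the power series
`𝒩h` uniquely"). This file proves the level independence and supplies the evaluation lemmas used in
the proof of the interpolation theorem I §2.2 (everything **proved**, `f = πX + X^q` over any
non-archimedean local field `F`):

* `seriesInclMap h` — the inclusion `𝒪_{E₁}⟦X⟧ → 𝒪_{E₂}⟦X⟧` along `E₁ ≤ E₂` (coefficientwise
  `inclUnitBall`), continuous, fixing `𝒪_F`-series, with `seriesInclMap_transl`:
  **`ι(h(X [+] ω)) = h(X [+] ι ω)`**.
* `exists_perm_inclPt_ltDivPt` — the `π`-division points of `K_π^{n+1}` map to those of `K_π^{m+1}` by a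
  permutation of the index set `𝓀`; hence ★ `colemanNorm_eq_of_le` / **`colemanNorm_level_eq :
  colemanNorm hπ n = colemanNorm hπ m`** (both solve `𝒩h ∘ f = ∏_{ω ∈ W_f^1} h(X [+] ω)` in
  `𝒪_{K_π^{m+1}}⟦X⟧`, and `g ↦ g ∘ f` is injective), and `colemanNormIter_level_eq`.
* `evalAt_subst_hom` — `(h ∘ [a]_f)(x) = h([a] x)`; `exists_isUnit_evalAt_ltAct_eq` — every unit `y` of
  `𝒪_{K_π^{n+1}}` is `h([u] λ_{n+1})` for some `h ∈ 𝒪_F⟦X⟧` with unit constant term, for any unit `u`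
  (the tree's `exists_series_of_norm_eq_one` transported from `λ_{n+1}` to `[u] λ_{n+1}`).
* Congruences: `colemanNormIter_sub_mem_coeffIdeal` (`𝒩^{(k)} h ≡ h (mod π)`, de Shalit (i) iterated),
  `norm_evalAt_le_of_mem_coeffIdeal` (`‖D(y)‖ ≤ ‖π‖^j` for `D ≡ 0 (mod π^j)`), and
  `norm_evalAt_sub_le_of_forall_lt` (`‖G(y) - G'(y)‖ ≤ max ‖π‖^a ‖y‖^K` when `G ≡ G' (mod π^a)` in
  degrees `< K` — the continuity estimate for evaluation used with the compactness of `𝒪_F^ℕ`).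

## References

* E. de Shalit, *Iwasawa theory of elliptic curves with complex multiplication* (1987), Ch. I §2.1
  Proposition (uniqueness in (1); (i)), §2.2 (proof). [cite: deShalit1987, Ch. I §2.1]
* R. Coleman, *Division values in local fields*, Invent. Math. 53 (1979).

## Mathlib reuse

`PowerSeries.mapAlgHom`, `PowerSeries.map_subst`, `PowerSeries.map_injective`, `Equiv.ofBijective`,
`Finite.injective_iff_bijective`, `IsUltrametricDist.norm_tsum_le_of_forall_le_of_nonneg`; from the tree:
`LubinTateColemanNorm.lean` (`colemanNorm`, `map_subst_colemanNorm`, `subst_injective_of_isDomain`,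
`ltDivPt`, `exists_eq_ltDivPt`, `algHom_evalAt/evalPt`), `LubinTateColeman.lean` (`transl`, `tPt`,
`nProd`, `subst_injective`, `coeffIdeal`), `LubinTateNormOperator.lean` (`colemanNormIter`,
`colemanNorm_sub_mem_coeffIdeal`), `LubinTateNormGroup.lean` (`exists_series_of_norm_eq_one`),
`LubinTateTowerGenerator.lean` / `LubinTateCharacterLimit.lean` (`inclUnitBall`, `inclPt`, `ltAct`).
-/

noncomputable section

open Filter Topology Polynomial ValuativeRel
open scoped PowerSeries.WithPiTopology

namespace Literature.NumberTheory.GaloisRepresentations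

section LocalFieldL

open GaloisRepresentations.IsNonarchimedeanLocalField LubinTate

variable (F : Type*) [Field F] [ValuativeRel F] [TopologicalSpace F] [IsNonarchimedeanLocalField F]

attribute [local instance] ltNormUniformSpace ltNormIsUniformAddGroup rk1 nF nE fintypeResidueField

variable {F}

/-! ### The inclusion `𝒪_{E₁}⟦X⟧ → 𝒪_{E₂}⟦X⟧` and translates -/

section SeriesIncl

variable {E₁ E₂ : IntermediateField F (AlgebraicClosure F)} [FiniteDimensional F E₁]
  [FiniteDimensional F E₂]

/-- The inclusion `𝒪_{E₁}⟦X⟧ → 𝒪_{E₂}⟦X⟧` (coefficientwise), as an algebra map over the coefficient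
ring `𝒪[F]`. [cite: deShalit1987, Ch. I §2.1] -/
def seriesInclMap (h : E₁ ≤ E₂) : PowerSeries (unitBall E₁) →ₐ[LTCoeff F] PowerSeries (unitBall E₂) :=
  PowerSeries.mapAlgHom (inclUnitBall h)

/-- `seriesInclMap h` is `PowerSeries.map` of the inclusion (unfolding). [cite: deShalit1987, Ch. I §2.1] -/
theorem seriesInclMap_apply (h : E₁ ≤ E₂) (G : PowerSeries (unitBall E₁)) :
    seriesInclMap h G = G.map (inclUnitBall h : unitBall E₁ →+* unitBall E₂) := by
  rw [seriesInclMap, PowerSeries.mapAlgHom_apply]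

/-- `seriesInclMap h` is continuous (product topology). [cite: deShalit1987, Ch. I §2.1] -/
theorem continuous_seriesInclMap (h : E₁ ≤ E₂) : Continuous (seriesInclMap (F := F) h) := by
  refine continuous_pi fun d => ?_
  have : (fun G : PowerSeries (unitBall E₁) => (seriesInclMap h G) d) =
      fun G => inclUnitBall h (G d) := by
    funext G
    rw [seriesInclMap_apply]
    exact MvPowerSeries.coeff_map _ _ _
  rw [this]
  exact (continuous_inclUnitBall h).comp (continuous_apply d)

/-- The inclusion fixes series with coefficients from `𝒪[F]`. [cite: deShalit1987, Ch. I §2.1] -/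
theorem seriesInclMap_map (h : E₁ ≤ E₂) (g : PowerSeries (LTCoeff F)) :
    seriesInclMap h (g.map (algebraMap (LTCoeff F) (unitBall E₁))) =
      g.map (algebraMap (LTCoeff F) (unitBall E₂)) := by
  rw [seriesInclMap_apply, ← RingHom.comp_apply, ← PowerSeries.map_comp, (inclUnitBall h).comp_algebraMap]

/-- `ι(X) = X`. [cite: deShalit1987, Ch. I §2.1] -/
theorem seriesInclMap_X (h : E₁ ≤ E₂) :
    seriesInclMap h (PowerSeries.X : PowerSeries (unitBall E₁)) = PowerSeries.X := by
  rw [seriesInclMap_apply, PowerSeries.map_X]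

/-- `ι(C s) = C (ι s)`. [cite: deShalit1987, Ch. I §2.1] -/
theorem seriesInclMap_C (h : E₁ ≤ E₂) (s : unitBall E₁) :
    seriesInclMap h (PowerSeries.C s) = PowerSeries.C (inclUnitBall h s) := by
  rw [seriesInclMap_apply, PowerSeries.map_C]; rfl

/-- The inclusion of a point of `𝒪_{E₁}⟦X⟧` (constant coefficient in `𝔪`) is a point of `𝒪_{E₂}⟦X⟧`.
[cite: deShalit1987, Ch. I §2.1] -/
def seriesInclMapPt (h : E₁ ≤ E₂) (t : (seriesNilIdeal (maxNilIdeal F E₁)).toIdeal) :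
    (seriesNilIdeal (maxNilIdeal F E₂)).toIdeal :=
  ⟨seriesInclMap h t, by
    rw [mem_seriesNilIdeal_iff, ← PowerSeries.coeff_zero_eq_constantCoeff_apply, seriesInclMap_apply,
      PowerSeries.coeff_map, PowerSeries.coeff_zero_eq_constantCoeff_apply]
    exact (inclPt h (ccPt (maxNilIdeal F E₁) t)).2⟩

/-- `seriesInclMapPt` is `seriesInclMap` (unfolding). [cite: deShalit1987, Ch. I §2.1] -/
@[simp] theorem coe_seriesInclMapPt (h : E₁ ≤ E₂) (t : (seriesNilIdeal (maxNilIdeal F E₁)).toIdeal) :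
    (seriesInclMapPt h t : PowerSeries (unitBall E₂)) = seriesInclMap h t := rfl

variable {π : 𝒪[F]} {hA : IsLTRing (LTCoeff.of F π) (residueFieldCard F)}

/-- **`ι(X [+] ω) = X [+] ι(ω)`** as points of `𝒪_{E₂}⟦X⟧`. [cite: deShalit1987, Ch. I §2.1] -/
theorem seriesInclMapPt_tPt (h : E₁ ≤ E₂) (ω : (maxNilIdeal F E₁).toIdeal) :
    seriesInclMapPt h (tPt (maxNilIdeal F E₁) hA (isLTSeries_LTCoeff π) ω) =
      tPt (maxNilIdeal F E₂) hA (isLTSeries_LTCoeff π) (inclPt h ω) := by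
  apply Subtype.ext
  change seriesInclMap h (evalPt (seriesNilIdeal (maxNilIdeal F E₁)) (formalGroup hA (isLTSeries_LTCoeff π)).toPowerSeries
    (formalGroup hA (isLTSeries_LTCoeff π)).zero_constantCoeff ![serX _, serC _ ω] : PowerSeries (unitBall E₁)) =
    (evalPt (seriesNilIdeal (maxNilIdeal F E₂)) (formalGroup hA (isLTSeries_LTCoeff π)).toPowerSeries
    (formalGroup hA (isLTSeries_LTCoeff π)).zero_constantCoeff ![serX _, serC _ (inclPt h ω)] : PowerSeries (unitBall E₂))
  refine algHom_evalPt (seriesNilIdeal (maxNilIdeal F E₁)) (seriesNilIdeal (maxNilIdeal F E₂))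
    (seriesInclMap h) (continuous_seriesInclMap h) (formalGroup hA (isLTSeries_LTCoeff π)).toPowerSeries
    (formalGroup hA (isLTSeries_LTCoeff π)).zero_constantCoeff
    ![serX (maxNilIdeal F E₁), serC (maxNilIdeal F E₁) ω]
    ![serX (maxNilIdeal F E₂), serC (maxNilIdeal F E₂) (inclPt h ω)] fun i => ?_
  fin_cases i
  · exact seriesInclMap_X h
  · exact seriesInclMap_C h _

/-- **`ι(h(X [+] ω)) = h(X [+] ι ω)`** for `h ∈ 𝒪_F⟦X⟧`: translates are compatible with the
inclusions of the tower. [cite: deShalit1987, Ch. I §2.1] -/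
theorem seriesInclMap_transl (h : E₁ ≤ E₂) (ω : (maxNilIdeal F E₁).toIdeal) (g : PowerSeries (LTCoeff F)) :
    seriesInclMap h (transl (maxNilIdeal F E₁) hA (isLTSeries_LTCoeff π) ω g) =
      transl (maxNilIdeal F E₂) hA (isLTSeries_LTCoeff π) (inclPt h ω) g := by
  rw [transl, transl]
  exact algHom_evalAt (seriesNilIdeal (maxNilIdeal F E₁)) (seriesNilIdeal (maxNilIdeal F E₂))
    (seriesInclMap h) (continuous_seriesInclMap h) g (tPt (maxNilIdeal F E₁) hA (isLTSeries_LTCoeff π) ω)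
    (tPt (maxNilIdeal F E₂) hA (isLTSeries_LTCoeff π) (inclPt h ω))
    (congrArg Subtype.val (seriesInclMapPt_tPt h ω))

end SeriesIncl

/-! ### Level independence of `𝒩` -/

variable {π : 𝒪[F]} (hπ : (valuation F).IsUniformizer (π : F))

/-- The inclusion of a `π`-division point is a `π`-division point. [cite: CasselsFrohlichANT1967, Ch. VI §3.6 Prop. 6 (a)] -/
theorem ltSMul_pi_inclPt_ltDivPt {n m : ℕ} (h : ltField π n ≤ ltField π m) (c : 𝓀[F]) :
    ltSMul (maxNilIdeal F (ltField π m)) (isLTRing_LTCoeff hπ) (isLTSeries_LTCoeff π) (LTCoeff.of F π)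
      (inclPt h (ltDivPt hπ n c)) = 0 := by
  apply Subtype.ext
  rw [← inclUnitBall_ltSMul h, ltSMul_ltDivPt, ZeroMemClass.coe_zero, ZeroMemClass.coe_zero, map_zero]

/-- **The `π`-division points along the tower**: for `n ≤ m` there is a permutation `τ` of `𝓀` with
`ι(ω_c^{(n)}) = ω_{τ c}^{(m)}` (the inclusion `K_π^{n+1} ⊆ K_π^{m+1}` maps `W_f^1` onto `W_f^1`).
[cite: CasselsFrohlichANT1967, Ch. VI §3.6 Prop. 6 (a)] -/
theorem exists_perm_inclPt_ltDivPt {n m : ℕ} (h : ltField π n ≤ ltField π m) :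
    ∃ τ : 𝓀[F] ≃ 𝓀[F], ∀ c, inclPt h (ltDivPt hπ n c) = ltDivPt hπ m (τ c) := by
  have hex : ∀ c, ∃ c', inclPt h (ltDivPt hπ n c) = ltDivPt hπ m c' := fun c =>
    exists_eq_ltDivPt hπ m (ltSMul_pi_inclPt_ltDivPt hπ h c)
  choose τ hτ using hex
  have hinj : Function.Injective τ := by
    intro c c' hcc'
    have h1 : inclPt h (ltDivPt hπ n c) = inclPt h (ltDivPt hπ n c') := by rw [hτ, hτ, hcc']
    have h2 : (((((ltDivPt hπ n c : (maxNilIdeal F (ltField π n)).toIdeal) : unitBall (ltField π n)) :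
        ltField π n) : AlgebraicClosure F)) =
        ((((ltDivPt hπ n c' : (maxNilIdeal F (ltField π n)).toIdeal) : unitBall (ltField π n)) :
          ltField π n) : AlgebraicClosure F) := by
      rw [← coe_inclPt h, ← coe_inclPt h, h1]
    exact ltDivPt_injective hπ n (pt_ext h2)
  exact ⟨Equiv.ofBijective τ (Finite.injective_iff_bijective.mp hinj), hτ⟩

/-- ★ **Coleman's norm operator does not depend on the level at which it is computed**:
`colemanNorm hπ n h = colemanNorm hπ m h` for `n ≤ m` (both, mapped into `𝒪_{K_π^{m+1}}⟦X⟧`, solve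
`𝒩h ∘ f = ∏_{ω ∈ W_f^1} h(X [+] ω)`, whose solution is unique).
[cite: deShalit1987, Ch. I §2.1 Proposition ("(1) characterizes `𝒩h` uniquely")] -/
theorem colemanNorm_eq_of_le {n m : ℕ} (hnm : n ≤ m) (h : PowerSeries (LTCoeff F)) :
    colemanNorm hπ n h = colemanNorm hπ m h := by
  have hle : ltField π n ≤ ltField π m := ltField_mono hπ hnm
  -- both `𝒩_n h ∘ f` and `𝒩_m h ∘ f` map to the Coleman product of level `m`
  have h1 : PowerSeries.map (algebraMap (LTCoeff F) (unitBall (ltField π m)))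
      (PowerSeries.subst (ltSer F π) (colemanNorm hπ n h)) =
      PowerSeries.map (algebraMap (LTCoeff F) (unitBall (ltField π m)))
        (PowerSeries.subst (ltSer F π) (colemanNorm hπ m h)) := by
    rw [map_subst_colemanNorm hπ m h, ← seriesInclMap_map hle, map_subst_colemanNorm hπ n h, nProd, nProd,
      map_prod]
    obtain ⟨τ, hτ⟩ := exists_perm_inclPt_ltDivPt hπ hle
    simp_rw [seriesInclMap_transl, hτ]
    exact Equiv.prod_comp τ (fun c => transl _ (isLTRing_LTCoeff hπ) (isLTSeries_LTCoeff π) (ltDivPt hπ m c) h)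
  have h2 : PowerSeries.subst (ltSer F π) (colemanNorm hπ n h) =
      PowerSeries.subst (ltSer F π) (colemanNorm hπ m h) :=
    PowerSeries.map_injective _ (algebraMap_LTCoeff_injective (ltField π m)) h1
  exact subst_injective (isLTRing_LTCoeff hπ) (isLTSeries_ltSer π) h2

/-- **`colemanNorm hπ n = colemanNorm hπ m`** for all levels. [cite: deShalit1987, Ch. I §2.1 Proposition] -/
theorem colemanNorm_level_eq (n m : ℕ) (h : PowerSeries (LTCoeff F)) :
    colemanNorm hπ n h = colemanNorm hπ m h := by
  rcases le_total n m with hnm | hmn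
  · exact colemanNorm_eq_of_le hπ hnm h
  · exact (colemanNorm_eq_of_le hπ hmn h).symm

/-- The iterates `𝒩^{(k)}` do not depend on the level either. [cite: deShalit1987, Ch. I §2.1 Proposition (iii)] -/
theorem colemanNormIter_level_eq (n m k : ℕ) (h : PowerSeries (LTCoeff F)) :
    colemanNormIter hπ n k h = colemanNormIter hπ m k h := by
  induction k generalizing h with
  | zero => rw [colemanNormIter_zero, colemanNormIter_zero]
  | succ k ih =>
    rw [colemanNormIter_succ, colemanNormIter_succ, colemanNorm_level_eq hπ n m, ih]

/-! ### Evaluation of `h ∘ [a]_f`; unit series through any primitive point -/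

variable {E : IntermediateField F (AlgebraicClosure F)} [FiniteDimensional F E]

/-- **`(h ∘ [a]_f)(x) = h([a] x)`** for `h ∈ 𝒪_F⟦X⟧` and a point `x` of `𝔪_E`.
[cite: deShalit1987, Ch. I §2.3 (iv) (proof)] -/
theorem evalAt_subst_hom (a : LTCoeff F) (h : PowerSeries (LTCoeff F)) (x : (maxNilIdeal F E).toIdeal) :
    evalAt (maxNilIdeal F E) x
        (PowerSeries.subst (hom (isLTRing_LTCoeff hπ) (isLTSeries_LTCoeff π) (isLTSeries_LTCoeff π) a) h) =
      evalAt (maxNilIdeal F E)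
        (ltSMul (maxNilIdeal F E) (isLTRing_LTCoeff hπ) (isLTSeries_LTCoeff π) a x) h := by
  rw [evalAt_apply, evalAt_apply, PowerSeries.aeval, PowerSeries.aeval, PowerSeries.subst]
  exact aeval_subst
    (a := fun _ : Unit => (hom (isLTRing_LTCoeff hπ) (isLTSeries_LTCoeff π) (isLTSeries_LTCoeff π) a :
      PowerSeries (LTCoeff F)))
    (MvPowerSeries.hasSubst_of_constantCoeff_zero fun _ =>
      constantCoeff_hom' (isLTRing_LTCoeff hπ) (isLTSeries_LTCoeff π) (isLTSeries_LTCoeff π) a)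
    _ _ _ fun _ => rfl

/-- The constant term of `h ∘ [a]_f` maps to that of `h` (evaluate at `0`: `[a] 0 = 0`).
[cite: deShalit1987, Ch. I §2.3 (iv) (proof)] -/
theorem isUnit_constantCoeff_subst_hom (a : LTCoeff F) {h : PowerSeries (LTCoeff F)}
    (hh : IsUnit (PowerSeries.constantCoeff h)) :
    IsUnit (PowerSeries.constantCoeff
      (PowerSeries.subst (hom (isLTRing_LTCoeff hπ) (isLTSeries_LTCoeff π) (isLTSeries_LTCoeff π) a) h)) := by
  have e := evalAt_subst_hom hπ (E := ltField π 0) a h 0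
  rw [ltSMul_zero, evalAt_zero, evalAt_zero] at e
  have e' := algebraMap_LTCoeff_injective (ltField π 0) e
  rw [e']
  exact hh

/-- **Every unit of `𝒪_{K_π^{n+1}}` is `h([u] λ_{n+1})` for some `h ∈ 𝒪_F⟦X⟧ˣ`**, for any unit `u`
(`𝒪_{K_π^{n+1}} = 𝒪_F[ω]` for every primitive division point `ω`).
[cite: SerreLocalFields1979, Ch. I §6 Prop. 18] -/
theorem exists_isUnit_evalAt_ltAct_eq (n : ℕ) (u : 𝒪[F]ˣ) (y : ltField π n) (hy : ‖y‖ = 1) :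
    ∃ h : PowerSeries (LTCoeff F), IsUnit (PowerSeries.constantCoeff h) ∧
      ((evalAt (maxNilIdeal F (ltField π n)) (ltAct hπ n (u : 𝒪[F]) (genPt hπ n)) h :
        unitBall (ltField π n)) : ltField π n) = y := by
  obtain ⟨h₀, hh₀, hval⟩ := exists_series_of_norm_eq_one hπ n y hy
  refine ⟨PowerSeries.subst (hom (isLTRing_LTCoeff hπ) (isLTSeries_LTCoeff π) (isLTSeries_LTCoeff π)
    (LTCoeff.of F ((u⁻¹ : 𝒪[F]ˣ) : 𝒪[F]))) h₀, isUnit_constantCoeff_subst_hom hπ _ hh₀, ?_⟩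
  rw [evalAt_subst_hom hπ, ltAct, ← mul_ltSMul, ← map_mul, Units.inv_mul, map_one, one_ltSMul]
  exact hval

/-! ### Congruences: `𝒩^{(k)} h ≡ h (mod π)` and values of congruent series -/

/-- **`𝒩^{(k)} h ≡ h (mod π)`** (de Shalit's (i) `𝒩h ≡ h^φ = h (mod π)` iterated).
[cite: deShalit1987, Ch. I §2.1 Proposition (i)] -/
theorem colemanNormIter_sub_mem_coeffIdeal (n k : ℕ) (h : PowerSeries (LTCoeff F)) :
    colemanNormIter hπ n k h - h ∈ coeffIdeal (Ideal.span {LTCoeff.of F π}) := by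
  induction k with
  | zero => rw [colemanNormIter_zero, sub_self]; exact zero_mem _
  | succ k ih =>
    rw [colemanNormIter_succ']
    have e : colemanNorm hπ n (colemanNormIter hπ n k h) - h =
        (colemanNorm hπ n (colemanNormIter hπ n k h) - colemanNormIter hπ n k h) +
          (colemanNormIter hπ n k h - h) := by ring
    rw [e]
    exact add_mem (colemanNorm_sub_mem_coeffIdeal hπ n _) ih

/-- A multiple of `π^j` in `𝒪[F]` has norm `≤ ‖π‖^j`. [cite: SerreLocalFields1979, Ch. I §1] -/
theorem norm_coe_le_pow_of_dvd {a : 𝒪[F]} {j : ℕ} (h : π ^ j ∣ a) : ‖(a : F)‖ ≤ ‖(π : F)‖ ^ j := by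
  obtain ⟨c, rfl⟩ := h
  rw [Subring.coe_mul, SubmonoidClass.coe_pow, norm_mul, norm_pow]
  calc ‖(π : F)‖ ^ j * ‖(c : F)‖ ≤ ‖(π : F)‖ ^ j * 1 := by
        gcongr; exact Valued.toNormedField.norm_le_one_iff.mpr c.2
    _ = ‖(π : F)‖ ^ j := mul_one _

/-- **`‖G(y)‖ ≤ C`** when every coefficient of `G ∈ 𝒪_E⟦X⟧` of degree `< K` has norm `≤ C` and
`‖y‖^K ≤ C` (`C ≥ 0`, `‖y‖ < 1`). [cite: deShalit1987, Ch. I §2.2 (proof)] -/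
theorem norm_aeval_le_of_coeff_le {L : Type*} [NontriviallyNormedField L] [IsUltrametricDist L]
    [CompleteSpace L] (G : PowerSeries (unitBall L)) {ω : unitBall L} (hω : ‖(ω : L)‖ < 1) {K : ℕ}
    {C : ℝ} (hC : 0 ≤ C) (hcoeff : ∀ k < K, ‖((PowerSeries.coeff k G : unitBall L) : L)‖ ≤ C)
    (hK : ‖(ω : L)‖ ^ K ≤ C) :
    ‖((PowerSeries.aeval (isTopologicallyNilpotent_of_norm_lt_one L hω) G : unitBall L) : L)‖ ≤ C := by
  rw [aeval_eq_tsum_coeff_mul_pow G hω]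
  change ‖(∑' j, PowerSeries.coeff j G * ω ^ j : unitBall L)‖ ≤ C
  refine IsUltrametricDist.norm_tsum_le_of_forall_le_of_nonneg hC fun j => ?_
  change ‖((PowerSeries.coeff j G * ω ^ j : unitBall L) : L)‖ ≤ C
  rw [Subring.coe_mul, SubmonoidClass.coe_pow, norm_mul, norm_pow]
  rcases lt_or_ge j K with hj | hj
  · calc ‖((PowerSeries.coeff j G : unitBall L) : L)‖ * ‖(ω : L)‖ ^ j ≤ C * 1 :=
          mul_le_mul (hcoeff j hj) (pow_le_one₀ (norm_nonneg _) hω.le) (pow_nonneg (norm_nonneg _) _) hC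
      _ = C := mul_one _
  · calc ‖((PowerSeries.coeff j G : unitBall L) : L)‖ * ‖(ω : L)‖ ^ j ≤ 1 * ‖(ω : L)‖ ^ K :=
          mul_le_mul (norm_coe_unitBall_le _) (pow_le_pow_of_le_one (norm_nonneg _) hω.le hj)
            (pow_nonneg (norm_nonneg _) _) zero_le_one
      _ ≤ C := by rw [one_mul]; exact hK

include hπ in
/-- **`‖D(y)‖ ≤ ‖π‖^j` when `D ≡ 0 (mod π^j)` coefficientwise** (`y ∈ 𝔪_E`).
[cite: deShalit1987, Ch. I §2.2 (proof, (3))] -/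
theorem norm_evalAt_le_of_mem_coeffIdeal {D : PowerSeries (LTCoeff F)} {j : ℕ}
    (hD : D ∈ coeffIdeal (Ideal.span {LTCoeff.of F π ^ j})) (y : (maxNilIdeal F E).toIdeal) :
    ‖((evalAt (maxNilIdeal F E) y D : unitBall E) : E)‖ ≤ ‖(π : F)‖ ^ j := by
  rw [evalAt_eq_evS_map]
  change ‖((PowerSeries.aeval _ (D.map (algebraMap (LTCoeff F) (unitBall E))) : unitBall E) : E)‖ ≤ _
  have hy : ‖((y : unitBall E) : E)‖ < 1 := y.2
  have hπpos : 0 < ‖(π : F)‖ ^ j := pow_pos (norm_pos_iff.mpr hπ.ne_zero) _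
  obtain ⟨K, hK⟩ := exists_pow_lt_of_lt_one hπpos hy
  refine norm_aeval_le_of_coeff_le (K := K) _ hy hπpos.le (fun k _ => ?_) hK.le
  rw [PowerSeries.coeff_map]
  have e : PowerSeries.coeff k D = LTCoeff.of F ((LTCoeff.of F).symm (PowerSeries.coeff k D)) :=
    (RingEquiv.apply_symm_apply _ _).symm
  rw [e, norm_algebraMap_LTCoeff]
  refine norm_coe_le_pow_of_dvd ?_
  have hk := hD k
  rw [Ideal.mem_span_singleton] at hk
  obtain ⟨c, hc⟩ := hk
  refine ⟨(LTCoeff.of F).symm c, (LTCoeff.of F).injective ?_⟩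
  rw [map_mul, map_pow, RingEquiv.apply_symm_apply, RingEquiv.apply_symm_apply]
  exact hc

/-- **`‖G(y) - G'(y)‖ ≤ max ‖π‖^a ‖y‖^K`** when `G ≡ G' (mod π^a)` in all degrees `< K`: evaluation
at a point of the open unit disc is continuous for the product of the `π`-adic topologies on the
coefficients. [cite: deShalit1987, Ch. I §2.2 (proof, "by continuity")] -/
theorem norm_evalAt_sub_le_of_forall_lt {G G' : PowerSeries (LTCoeff F)} {a K : ℕ}
    (hGG' : ∀ k < K, LTCoeff.of F π ^ a ∣ PowerSeries.coeff k G - PowerSeries.coeff k G')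
    (y : (maxNilIdeal F E).toIdeal) :
    ‖((evalAt (maxNilIdeal F E) y G : unitBall E) : E) - ((evalAt (maxNilIdeal F E) y G' : unitBall E) : E)‖ ≤
      max (‖(π : F)‖ ^ a) (‖((y : unitBall E) : E)‖ ^ K) := by
  rw [← AddSubgroupClass.coe_sub, ← map_sub, evalAt_eq_evS_map]
  change ‖((PowerSeries.aeval _ ((G - G').map (algebraMap (LTCoeff F) (unitBall E))) : unitBall E) : E)‖ ≤ _
  have hy : ‖((y : unitBall E) : E)‖ < 1 := y.2
  refine norm_aeval_le_of_coeff_le (K := K) _ hy (le_max_of_le_right (pow_nonneg (norm_nonneg _) _))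
    (fun k hk => ?_) (le_max_right _ _)
  refine le_trans ?_ (le_max_left _ _)
  rw [PowerSeries.coeff_map, map_sub]
  have e : PowerSeries.coeff k G - PowerSeries.coeff k G' =
      LTCoeff.of F ((LTCoeff.of F).symm (PowerSeries.coeff k G - PowerSeries.coeff k G')) :=
    (RingEquiv.apply_symm_apply _ _).symm
  rw [e, norm_algebraMap_LTCoeff]
  refine norm_coe_le_pow_of_dvd ?_
  obtain ⟨c, hc⟩ := hGG' k hk
  refine ⟨(LTCoeff.of F).symm c, (LTCoeff.of F).injective ?_⟩
  rw [map_mul, map_pow, RingEquiv.apply_symm_apply, RingEquiv.apply_symm_apply]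
  exact hc

end LocalFieldL

end Literature.NumberTheory.GaloisRepresentations
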